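import Mathlib
import HarnessLib
import Literature.Probability.MarkovChains.MetropolisHastings
import Literature.Probability.MarkovChains.TotalVariation
import Summits.Ventures.LatticeQCDFlow.Exactness.JarzynskiFinite
import Summits.Ventures.LatticeQCDFlow.Exactness.FlowMCMC
import Summits.Ventures.LatticeQCDFlow.Scaling.ImportanceWeights
import Summits.Ventures.LatticeQCDFlow.Scaling.StochasticFlows
import Summits.Ventures.LatticeQCDFlow.Scaling.StochasticBudgets
import Summits.Ventures.LatticeQCDFlow.Scaling.PerfectRelaxationMonotone
import Summits.Ventures.LatticeQCDFlow.Scaling.PerfectRelaxationFKG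

/-!
# Flow-MCMC (independence Metropolis–Hastings) layers are MONOTONE when the importance weight is
# monotone in the action — so perfect relaxation dominates them (pub-lqcd THEORY-2 v2.5, §3.5 / §4
# row C3, item (C3-IMH))

HONEST FRAMING: exact (Metropolis-corrected) sampling algorithms for lattice gauge theory; figures
of merit are autocorrelation/cost numbers at stated couplings and volumes; no continuum-physics
claim.  Finite state spaces throughout.

The relaxation layers of a stochastic normalizing flow / annealed flow sampler are typically
FLOW-MCMC steps: independence Metropolis–Hastings (`Exactness.imhKernel p q`) with the model law
`q` as proposal and the next intermediate law `p` as target.  This file decides when such layers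
fall under the proved dominance theorem (C3″)
(`Theory2.perfectRelaxation_dominates_expFamily'`): they do as soon as the importance weight
`w = p/q` is MONOTONE along the action `A` — in either direction.

* `imhKernel_sum_mul` — the action of the flow-MCMC kernel on functions:
  `(Pf)(x) = f x + Σ_z min(q z, p z · q x / p x) · (f z − f x)`;
* `imhRate_eq_of_le`, `imhRate_le_of_le` — the off-diagonal rate `min(q z, p z q x / p x)` equals
  `q z` when `w z ≥ w x` and is antitone in `w x`;
* `imhKernel_monotone_of_weight_antitone`, `imhKernel_monotone_of_weight_monotone` — if
  `w = p/q` is antitone (resp. monotone) with respect to the total preorder `A x ≤ A y`, the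
  flow-MCMC kernel maps functions decreasing in `A` to functions decreasing in `A` (stochastic
  monotonicity, hypothesis `hmono` of (C3″));
* `perfectRelaxation_dominates_imh` — **(C3-IMH)**, general form: monotone increments in `A`,
  flow-MCMC layers with positive model laws whose importance weights are monotone in `A` (either
  direction, layer by layer) ⟹ `ÊSS ≤ Π_k ESS(p_{k+1}, p_k)`;
* `perfectRelaxation_dominates_imh_expFamily` — **(C3-IMH)**: annealing `p_k ∝ e^{−β_k A}`
  (`β` monotone) with flow-MCMC layers whose model laws are ANY members `e^{−γ_k A}` of the same
  one-parameter family (no condition on `γ_k`: arbitrarily well or badly temperature-matched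
  models) satisfies `ÊSS ≤ Π_k ESS(p_{k+1}, p_k)` — it never beats perfect relaxation.

Recorded alongside (THEORY-2.md §3.5, numerical, not a theorem): for GENERIC model laws `q`
(not weight-monotone in `A`) the flow-MCMC layer can be non-monotone and CAN exceed perfect
relaxation (`ÊSS / Π ESS` up to `1.005` on 4-state examples) — the same super-relaxation effect
as over-relaxation; so weight-monotonicity is the operative hypothesis, not IMH structure alone.

References: Liu, *Metropolized independent sampling*, Stat. Comput. 6 (1996) (the IMH kernel and
its ordering by importance weights); Albergo–Kanwar–Shanahan, PRD 100 (2019) 034515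
(flow-MCMC); THEORY-2.md §3.5.  All statements below are elementary. [folklore]
-/

namespace Summit.Ventures.LatticeQCDFlow.Theory2

open Finset Literature.Probability.MarkovChains Summit.Ventures.LatticeQCDFlow.Exactness

variable {X : Type*} [Fintype X] [DecidableEq X]

/-! ## The flow-MCMC kernel acting on functions -/

/-- The flow-MCMC kernel acts by `(Pf)(x) = f x + Σ_z min(q z, p z q x / p x)(f z − f x)` (the
`z = x` term vanishes, so the diagonal needs no special treatment). [folklore] -/
theorem imhKernel_sum_mul (p q f : X → ℝ) (x : X) :
    ∑ z, imhKernel p q x z * f z =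
      f x + ∑ z, mhRate (fun _ y => q y) p x z * (f z - f x) := by
  unfold imhKernel
  rw [← add_sum_erase _ _ (mem_univ x), mhKernel_self,
    ← add_sum_erase univ (fun z => mhRate (fun _ y => q y) p x z * (f z - f x)) (mem_univ x)]
  have h : ∑ z ∈ univ.erase x, mhKernel (fun _ y => q y) p x z * f z =
      ∑ z ∈ univ.erase x, mhRate (fun _ y => q y) p x z * f z :=
    sum_congr rfl fun z hz => by rw [mhKernel_of_ne (ne_of_mem_erase hz)]
  rw [h]
  simp only [sub_self, mul_zero, zero_add, mul_sub, sum_sub_distrib, ← sum_mul]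
  ring

omit [Fintype X] [DecidableEq X] in
/-- The off-diagonal flow-MCMC rate is the full proposal probability `q z` whenever the
destination has the larger importance weight: `w x ≤ w z`, i.e. `p x q z ≤ p z q x`.
[folklore] -/
theorem imhRate_eq_of_le {p : X → ℝ} (hp : ∀ x, 0 < p x) (q : X → ℝ) {x z : X}
    (h : p x * q z ≤ p z * q x) : mhRate (fun _ y => q y) p x z = q z := by
  show min (q z) (p z * q x / p x) = q z
  exact min_eq_left ((le_div_iff₀ (hp x)).2 (by linarith [mul_comm (q z) (p x)]))

omit [Fintype X] [DecidableEq X] in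
/-- The off-diagonal flow-MCMC rate out of `x` is antitone in the importance weight of `x`:
`w y ≤ w x` (`p y q x ≤ p x q y`) gives `rate x z ≤ rate y z` for every `z`. [folklore] -/
theorem imhRate_le_of_le {p : X → ℝ} (hp : ∀ x, 0 < p x) (q : X → ℝ)
    {x y : X} (h : p y * q x ≤ p x * q y) (z : X) :
    mhRate (fun _ y => q y) p x z ≤ mhRate (fun _ y => q y) p y z := by
  show min (q z) (p z * q x / p x) ≤ min (q z) (p z * q y / p y)
  refine min_le_min_left (q z) ?_
  rw [div_le_div_iff₀ (hp x) (hp y)]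
  nlinarith [(hp z).le, h]

omit [DecidableEq X] in
/-- Row mass of the off-diagonal rates is at most one (`rate x z ≤ q z`, `Σ q = 1`). [folklore] -/
theorem sum_imhRate_le_one (p : X → ℝ) {q : X → ℝ} (hq1 : ∑ x, q x = 1) (x : X) :
    ∑ z, mhRate (fun _ y => q y) p x z ≤ 1 :=
  hq1 ▸ sum_le_sum fun z _ => mhRate_le _ p x z

/-! ## Stochastic monotonicity of flow-MCMC layers -/

/-- **Flow-MCMC is monotone when the importance weight is ANTITONE in the action.**  If
`w = p/q` decreases along `A` (`A x ≤ A y → p y q x ≤ p x q y`), then the flow-MCMC kernel maps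
every function decreasing in `A` to a function decreasing in `A` (no sign or normalisation
condition on `q` beyond `Σ q = 1`).  Proof: with `r(x,z)` the off-diagonal rate,
`(Pf)(x) − (Pf)(y) = (f x − f y)(1 − Σ_z r(y,z)) + Σ_z (r(x,z) − r(y,z))(f z − f x)`, and each
summand is `0` (if `A z ≤ A x`, both rates are `q z`) or a product of two non-positive
numbers. [folklore] -/
theorem imhKernel_monotone_of_weight_antitone {p q : X → ℝ} (hp : ∀ x, 0 < p x)
    (hq1 : ∑ x, q x = 1) (A : X → ℝ)
    (hw : ∀ x y, A x ≤ A y → p y * q x ≤ p x * q y) (f : X → ℝ)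
    (hf : ∀ x y, A x ≤ A y → f y ≤ f x) (x y : X) (hxy : A x ≤ A y) :
    ∑ z, imhKernel p q y z * f z ≤ ∑ z, imhKernel p q x z * f z := by
  rw [imhKernel_sum_mul, imhKernel_sum_mul, ← sub_nonneg]
  have key : f x + ∑ z, mhRate (fun _ y => q y) p x z * (f z - f x) -
      (f y + ∑ z, mhRate (fun _ y => q y) p y z * (f z - f y)) =
      (f x - f y) * (1 - ∑ z, mhRate (fun _ y => q y) p y z) +
        ∑ z, (mhRate (fun _ y => q y) p x z - mhRate (fun _ y => q y) p y z) * (f z - f x) := by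
    simp only [sub_mul, mul_sub, sum_sub_distrib, ← sum_mul, mul_one]
    ring
  rw [key]
  refine add_nonneg (mul_nonneg (sub_nonneg.2 (hf x y hxy))
    (sub_nonneg.2 (sum_imhRate_le_one p hq1 y))) (sum_nonneg fun z _ => ?_)
  by_cases hzx : A z ≤ A x
  · rw [imhRate_eq_of_le hp q (hw z x hzx), imhRate_eq_of_le hp q (hw z y (hzx.trans hxy)),
      sub_self, zero_mul]
  · push Not at hzx
    exact mul_nonneg_of_nonpos_of_nonpos (sub_nonpos.2 (imhRate_le_of_le hp q (hw x y hxy) z))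
      (sub_nonpos.2 (hf x z hzx.le))

/-- **Flow-MCMC is monotone when the importance weight is MONOTONE in the action.**  If
`w = p/q` increases along `A` (`A x ≤ A y → p x q y ≤ p y q x`), the same conclusion holds; now
`(Pf)(x) − (Pf)(y) = (f x − f y)(1 − Σ_z r(x,z)) + Σ_z (r(x,z) − r(y,z))(f z − f y)` with every
summand `0` (if `A y ≤ A z`) or a product of two non-negative numbers. [folklore] -/
theorem imhKernel_monotone_of_weight_monotone {p q : X → ℝ} (hp : ∀ x, 0 < p x)
    (hq1 : ∑ x, q x = 1) (A : X → ℝ)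
    (hw : ∀ x y, A x ≤ A y → p x * q y ≤ p y * q x) (f : X → ℝ)
    (hf : ∀ x y, A x ≤ A y → f y ≤ f x) (x y : X) (hxy : A x ≤ A y) :
    ∑ z, imhKernel p q y z * f z ≤ ∑ z, imhKernel p q x z * f z := by
  rw [imhKernel_sum_mul, imhKernel_sum_mul, ← sub_nonneg]
  have key : f x + ∑ z, mhRate (fun _ y => q y) p x z * (f z - f x) -
      (f y + ∑ z, mhRate (fun _ y => q y) p y z * (f z - f y)) =
      (f x - f y) * (1 - ∑ z, mhRate (fun _ y => q y) p x z) +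
        ∑ z, (mhRate (fun _ y => q y) p x z - mhRate (fun _ y => q y) p y z) * (f z - f y) := by
    simp only [sub_mul, mul_sub, sum_sub_distrib, ← sum_mul, mul_one]
    ring
  rw [key]
  refine add_nonneg (mul_nonneg (sub_nonneg.2 (hf x y hxy))
    (sub_nonneg.2 (sum_imhRate_le_one p hq1 x))) (sum_nonneg fun z _ => ?_)
  by_cases hyz : A y ≤ A z
  · rw [imhRate_eq_of_le hp q (hw x z (hxy.trans hyz)), imhRate_eq_of_le hp q (hw y z hyz),
      sub_self, zero_mul]
  · push Not at hyz
    exact mul_nonneg (sub_nonneg.2 (imhRate_le_of_le hp q (hw x y hxy) z))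
      (sub_nonneg.2 (hf z y hyz.le))

/-! ## (C3-IMH): perfect relaxation dominates weight-monotone flow-MCMC layers -/

/-- **(C3-IMH), general form (proved).**  Along a protocol `S_0, …, S_n` whose increments are
monotone in the action coordinate `A`, flow-MCMC layers `imhKernel e^{−S_{k+1}} q_k` with model laws
`q_k > 0`, `Σ q_k = 1`, whose importance weights `e^{−S_{k+1}}/q_k` are each monotone in `A` (in
either direction, layer by layer) satisfy `ÊSS ≤ Π_k ESS(p_{k+1}, p_k)`. [folklore] -/
theorem perfectRelaxation_dominates_imh [Nonempty X] {n : ℕ} (A : X → ℝ)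
    (S : Fin (n + 1) → X → ℝ) (q : Fin n → X → ℝ)
    (hinc : ∀ (k : Fin n) (x y : X), A x ≤ A y →
      S k.succ x - S k.castSucc x ≤ S k.succ y - S k.castSucc y)
    (hq : ∀ k x, 0 < q k x) (hq1 : ∀ k, ∑ x, q k x = 1)
    (hw : ∀ k : Fin n,
      (∀ x y, A x ≤ A y → Real.exp (-(S k.succ y)) * q k x ≤ Real.exp (-(S k.succ x)) * q k y) ∨
      (∀ x y, A x ≤ A y → Real.exp (-(S k.succ x)) * q k y ≤ Real.exp (-(S k.succ y)) * q k x)) :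
    essFrac (revPathLaw S fun k => imhKernel (fun x => Real.exp (-(S k.succ x))) (q k))
        (pathLaw (gibbsLaw (S 0)) fun k => imhKernel (fun x => Real.exp (-(S k.succ x))) (q k)) ≤
      ∏ k : Fin n, essFrac (gibbsLaw (S k.succ)) (gibbsLaw (S k.castSucc)) := by
  have hp : ∀ (k : Fin n) (x : X), 0 < Real.exp (-(S k.succ x)) := fun k x => Real.exp_pos _
  refine perfectRelaxation_dominates_monotone' A S _ hinc
    (fun k => (imhKernel_isRowStochastic (hp k) (fun x => (hq k x).le) (hq1 k)).1)
    (fun k => imhKernel_isStationary (hp k) _) fun k f hf x y hxy => ?_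
  rcases hw k with h | h
  · exact imhKernel_monotone_of_weight_antitone (hp k) (hq1 k) A h f hf x y hxy
  · exact imhKernel_monotone_of_weight_monotone (hp k) (hq1 k) A h f hf x y hxy


/-- **(C3-IMH) PERFECT RELAXATION DOMINATES FLOW-MCMC LAYERS WITH ONE-PARAMETER-FAMILY MODELS
(proved).**  Anneal `p_k ∝ e^{−β_k A}` with `β` monotone; let layer `k` be the flow-MCMC
(independence Metropolis–Hastings) kernel with target `e^{−β_{k+1} A}` and model law the
normalised `e^{−γ_k A}` for ARBITRARY `γ_k : ℝ` (hotter, colder, equal: no condition).  Then the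
importance weight `e^{−(β_{k+1} − γ_k) A}` is monotone in `A` in one direction or the other, every
layer is stochastically monotone, and (C3″) gives `ÊSS ≤ Π_k ESS(p_{k+1}, p_k)`.  (For model laws
outside the family the layer can be non-monotone and the inequality can fail — THEORY-2.md §3.5
records 4-state examples with ratio `1.005`.) [folklore] -/
theorem perfectRelaxation_dominates_imh_expFamily (Y : Type) [Fintype Y] [DecidableEq Y]
    [Nonempty Y] (n : ℕ) (A : Y → ℝ) (β : Fin (n + 1) → ℝ) (γ : Fin n → ℝ) (hβ : Monotone β) :
    essFrac
        (revPathLaw (fun k x => β k * A x) fun k =>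
          imhKernel (fun x => Real.exp (-(β k.succ * A x))) (gibbsLaw fun x => γ k * A x))
        (pathLaw (gibbsLaw fun x => β 0 * A x) fun k =>
          imhKernel (fun x => Real.exp (-(β k.succ * A x))) (gibbsLaw fun x => γ k * A x)) ≤
      ∏ k : Fin n, essFrac (gibbsLaw fun x => β k.succ * A x)
        (gibbsLaw fun x => β k.castSucc * A x) := by
  have hp : ∀ (k : Fin n) (x : Y), 0 < Real.exp (-(β k.succ * A x)) := fun k x => Real.exp_pos _
  have hq : ∀ (k : Fin n) (x : Y), 0 ≤ gibbsLaw (fun x => γ k * A x) x :=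
    fun k x => (gibbsLaw_pos _ x).le
  have hq1 : ∀ k : Fin n, ∑ x, gibbsLaw (fun x => γ k * A x) x = 1 := fun k => sum_gibbsLaw _
  refine perfectRelaxation_dominates_expFamily' Y n A β _ hβ
    (fun k => imhKernel_isRowStochastic (hp k) (hq k) (hq1 k))
    (fun k => imhKernel_detailedBalance (hp k) _) fun k f hf x y hxy => ?_
  -- the weight `e^{−β A}/gibbsLaw(γ A) = Z_γ · e^{−(β − γ) A}` is monotone in `A`, in one direction
  have hcross : ∀ x y : Y, Real.exp (-(β k.succ * A y)) * gibbsLaw (fun x => γ k * A x) x ≤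
      Real.exp (-(β k.succ * A x)) * gibbsLaw (fun x => γ k * A x) y ↔
        (β k.succ - γ k) * A x ≤ (β k.succ - γ k) * A y := by
    intro x y
    have hZ : 0 < partitionFn (fun x => γ k * A x) := partitionFn_pos _
    simp only [gibbsLaw]
    rw [mul_div_assoc', mul_div_assoc', div_le_div_iff_of_pos_right hZ, ← Real.exp_add,
      ← Real.exp_add, Real.exp_le_exp]
    constructor <;> intro h <;> linarith
  rcases le_total (γ k) (β k.succ) with hle | hle
  · refine imhKernel_monotone_of_weight_antitone (hp k) (hq1 k) A
      (fun x y hxy => (hcross x y).2 ?_) f hf x y hxy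
    exact mul_le_mul_of_nonneg_left hxy (sub_nonneg.2 hle)
  · refine imhKernel_monotone_of_weight_monotone (hp k) (hq1 k) A
      (fun x y hxy => ?_) f hf x y hxy
    have h := (hcross y x).2 (mul_le_mul_of_nonpos_left hxy (sub_nonpos.2 hle))
    exact h

end Summit.Ventures.LatticeQCDFlow.Theory2
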